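import Mathlib
import HarnessLib
import Summits.Langlands.Langlands.Theorems.ParityBlindBianchiArtinWeightRealisationLevelSolvableSector
import Literature.NumberTheory.Automorphic.PiOfArtinRepAtSigmaUnramifiedPlaces

/-!
# The solvable sector of R′ = `ParityBlindBianchi.ArtinWeightRealisationLevel` (crux stmt-Langlands-15111)
modulo NAMED facts only — line `Sketch`, final bookkeeping (`--supports`)

The lead composition `artinWeightRealisationLevel_of_artinWeightRealisation` (landed,
`ParityBlindBianchiArtinWeightRealisationLevel.lean`) takes the two classical inputs written out.
Both are now vendored as Literature named facts (D-0014):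

* `Literature.NumberTheory.Automorphic.frobSatakeCompatibleAt_of_isPiOfArtinRep_of_isUnramifiedAt`
  (Gelbart 1997 Prop. 4.1, σ-unramified shadow; `Automorphic/PiOfArtinRepAtSigmaUnramifiedPlaces`);
* `Literature.NumberTheory.Automorphic.nonempty_cuspidalAutomorphicRepData_two` (cusp forms exist on
  `GL₂` over every number field, Gelbart 1975 Thm. 7.11 / Jacquet–Langlands §12;
  `Automorphic/CuspidalRepGL2Exists`).

This file restates the solvable sector (`satakeFrobCompatibleAt_of_isSolvable_projectiveImage` of
`…SolvableSector`, hypothesis `hG` written out there) against the first NAMED fact: modulo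
`strongArtin_of_isSolvable` (Langlands–Tunnell) and Gelbart's Prop. 4.1 σ-shadow only — no open
item.  (The full composition against both facts is `artinWeightRealisationLevel_of_facts` of
`…Modulo`.)  No definitions.
-/

noncomputable section

open scoped BigOperators Topology Classical Matrix NumberField MatrixGroups
open Literature.NumberTheory.Automorphic Literature.NumberTheory.GaloisRepresentations
  IsDedekindDomain NumberField Filter

-- `Summit.Langlands.Langlands.…`: summit = sub-problem name (D-0017 nested layout), not a typo.
set_option linter.dupNamespace false

namespace Summit.Langlands.Langlands.Theorems.ArtinWeightRealisationLevel

/-- **The solvable sector modulo named facts only (no open item).**  Langlands–Tunnell in automorphic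
form (`strongArtin_of_isSolvable`) and Gelbart 1997 Prop. 4.1 (σ-unramified shadow) give, for every
finite-image irreducible `σ : Γ_K → GL₂(ℚ̄_p)` with solvable projective image over any number field
`K`, a cuspidal `π` of `GL₂(𝔸_K)` with `SatakeFrobCompatibleAt ι π σ w` at every place where `σ` is
unramified. [folklore] -/
theorem satakeFrobCompatibleAt_of_isSolvable_projectiveImage_of_facts : strongArtin_of_isSolvable → Literature.NumberTheory.Automorphic.frobSatakeCompatibleAt_of_isPiOfArtinRep_of_isUnramifiedAt → ∀ (K : Type) [Field K] [NumberField K] (p : ℕ) [Fact p.Prime] (ι : PadicAlgCl p ≃+* ℂ) (σ : FramedGaloisRep K (PadicAlgCl p) 2), Finite σ.toMonoidHom.range → σ.toGaloisRep.IsIrreducible → IsSolvable (projectiveImage σ.toMonoidHom) → ∃ (hcpt : isCompact_glFiniteIntegralLevel 2 K) (π : CuspidalAutomorphicRepData 2 K hcpt), ∀ w : HeightOneSpectrum (𝓞 K), σ.IsUnramifiedAt w → Summit.Langlands.SatakeFrobCompatibleAt ι π.1 σ w :=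
  fun hLT hG => satakeFrobCompatibleAt_of_isSolvable_projectiveImage hLT
    (fun hcpt σ π hπ v hv => hG hcpt σ π hπ v hv)

end Summit.Langlands.Langlands.Theorems.ArtinWeightRealisationLevel

end
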